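import Summits.Ventures.WeilGRH.TwistedSechSinIntegral
import Summits.RiemannHypothesis.RiemannHypothesis.Theorems.WeilFormatCArchSectorEntries
import HarnessLib

/-!
# GRH arm (rh-explicit, venture WeilGRH): the `sech` bonus block — sector columns in closed form and their decay

Cell `rh-explicit`, WEIL TRACK — GRH ARM (lit/typing seat weil-grh-5 gen11; weil-grh-2 gen7's ASK, INBOX 2026-08-23T09:30Z:
«ONE more κ for the sech column tail»).  With `I_p = ∫_{(0,2a]} σ(t) sin(π p t/a) dt` (`σ = 1/(2cosh(t/2))`; `I_{−p} = −I_p`,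
`I_0 = 0`, `|p|·|I_p| ≤ a/π` by `TwistedSechSinIntegral.lean`) the off-diagonal entries of weil-grh-1's `sechIncrCoeff a`
are `−(−1)^{n+m}(I_m − I_n)/(π(n−m))`, so the SectorSplit columns of the bonus block `Π = πδ − sechIncrCoeff a` are, for a
row `n` and a far column `m ∉ {±n}`:

* `sechBonus_evenCol_eq` — even sector: `Π⁺(n,m) = (−1)^{n+m}(m I_m − n I_n)/(π(n² − m²))`;
* `sechBonus_oddCol_eq` — odd sector (`n = k+1`, `p = l+1`): `Π⁻(k,l) = (−1)^{n+p}(n I_p − p I_n)/(π(n² − p²))`;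
* `abs_sechBonus_evenCol_le` — `2n ≤ m`, `1 ≤ m` ⟹ `|Π⁺(n,m)| ≤ 8a/(3π² m²)` (decay `m⁻²`: the even sector is where the
  parity-0 kernel fails for the small odd conductors, weil-grh-2 gen7 STATUS 1 (2));
* `abs_sechBonus_oddCol_le` — `2(k+1) ≤ l+1` ⟹ `|Π⁻(k,l)| ≤ 8a/(3π²(k+1)(l+1))` (decay `l⁻¹` with row weight `(k+1)⁻¹`:
  the odd-sector combination keeps a `2I_n/(πm)` term).

These are the column bounds from which the parity-1 tail majorants follow (Cauchy–Schwarz over the block and weil-10's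
`Σ_{m≥B₃} m^{−2e}` bounds, Peter–Paul against the parity-0 majorants) — successor file.  No definitions; no named facts;
RH/GRH-free; standard axioms.
-/

set_option autoImplicit false

noncomputable section

open MeasureTheory Set
open scoped Real

namespace Summit.Ventures.WeilGRH

open Summit.RiemannHypothesis.RiemannHypothesis.Theorems.WeilFormatC

variable {a : ℝ}

/-! ## The sine moments -/

section Moments

/-- `I_{−p} = −I_p`. -/
theorem sechSinMoment_neg (a : ℝ) (p : ℤ) :
    (∫ t in Ioc 0 (2 * a), 1 / (2 * Real.cosh (t / 2)) * Real.sin (π * ((-p : ℤ) : ℝ) / a * t))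
      = -∫ t in Ioc 0 (2 * a), 1 / (2 * Real.cosh (t / 2)) * Real.sin (π * p / a * t) := by
  rw [← integral_neg]
  refine integral_congr_ae (Filter.Eventually.of_forall fun t ↦ ?_)
  simp only
  rw [Int.cast_neg, show π * -(p : ℝ) / a * t = -(π * p / a * t) by ring, Real.sin_neg, mul_neg]

/-- `I_0 = 0`. -/
theorem sechSinMoment_zero (a : ℝ) :
    (∫ t in Ioc 0 (2 * a), 1 / (2 * Real.cosh (t / 2)) * Real.sin (π * ((0 : ℤ) : ℝ) / a * t)) = 0 := by
  simp

/-- `|p|·|I_p| ≤ a/π` (`a > 0`; trivial at `p = 0`). -/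
theorem abs_mul_abs_sechSinMoment_le (ha : 0 < a) (p : ℤ) :
    |(p : ℝ)| * |∫ t in Ioc 0 (2 * a), 1 / (2 * Real.cosh (t / 2)) * Real.sin (π * p / a * t)| ≤ a / π := by
  by_cases hp : p = 0
  · subst hp
    simp only [Int.cast_zero, abs_zero, zero_mul]
    positivity
  · have h := abs_setIntegral_sech_mul_sin_freq_le ha hp
    have hpabs : 0 < |(p : ℝ)| := abs_pos.mpr (by exact_mod_cast hp)
    calc |(p : ℝ)| * |∫ t in Ioc 0 (2 * a), 1 / (2 * Real.cosh (t / 2)) * Real.sin (π * p / a * t)|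
        ≤ |(p : ℝ)| * (a / (π * |(p : ℝ)|)) := mul_le_mul_of_nonneg_left h hpabs.le
      _ = a / π := by field_simp

end Moments

/-! ## Sector columns of the bonus block in closed form -/

section Columns

/-- **Even-sector far column of the bonus block**: for `m ≠ 0`, `n ≠ m` (naturals),
`Π⁺(n,m) = (−1)^{n+m}(m I_m − n I_n)/(π(n² − m²))`. -/
theorem sechBonus_evenCol_eq (a : ℝ) {n m : ℕ} (hm : m ≠ 0) (hnm : n ≠ m) :
    (if n = 0 then ((if (0 : ℤ) = (m : ℤ) then π else 0) - sechIncrCoeff a 0 m)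
      else if m = 0 then ((if (n : ℤ) = 0 then π else 0) - sechIncrCoeff a n 0)
      else (((if (n : ℤ) = m then π else 0) - sechIncrCoeff a n m)
        + ((if (n : ℤ) = -(m : ℤ) then π else 0) - sechIncrCoeff a n (-(m : ℤ)))) / 2)
      = (-1 : ℝ) ^ ((n : ℤ) + m) * ((m : ℝ) * (∫ t in Ioc 0 (2 * a), 1 / (2 * Real.cosh (t / 2)) * Real.sin (π * m / a * t))
          - n * ∫ t in Ioc 0 (2 * a), 1 / (2 * Real.cosh (t / 2)) * Real.sin (π * n / a * t))
        / (π * ((n : ℝ) ^ 2 - (m : ℝ) ^ 2)) := by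
  have hm' : (m : ℝ) ≠ 0 := by exact_mod_cast hm
  have h0m : (0 : ℤ) ≠ (m : ℤ) := by exact_mod_cast (Ne.symm hm)
  have hnmZ : (n : ℤ) ≠ (m : ℤ) := by exact_mod_cast hnm
  have hnmR : (n : ℝ) - m ≠ 0 := sub_ne_zero.mpr (by exact_mod_cast hnm)
  have hnpm : (n : ℝ) + m ≠ 0 := by positivity
  by_cases hn : n = 0
  · subst hn
    rw [if_pos rfl, if_neg h0m]
    unfold sechIncrCoeff
    rw [if_neg h0m]
    have hI0 := sechSinMoment_zero a
    simp only [Int.cast_zero] at hI0 ⊢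
    rw [hI0]
    simp only [Int.cast_natCast, Nat.cast_zero, sub_zero]
    set Im := ∫ t in Ioc 0 (2 * a), 1 / (2 * Real.cosh (t / 2)) * Real.sin (π * (m : ℝ) / a * t) with hIm
    field_simp
    ring
  · have hn0 : (n : ℤ) ≠ 0 := by exact_mod_cast hn
    have hnneg : (n : ℤ) ≠ -(m : ℤ) := by omega
    rw [if_neg hn, if_neg hm, if_neg hnmZ, if_neg hnneg]
    unfold sechIncrCoeff
    rw [if_neg hnmZ, if_neg hnneg, sechSinMoment_neg a m, neg_one_zpow_add_neg]
    simp only [Int.cast_natCast, Int.cast_neg]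
    have hnpm' : (n : ℝ) - -(m : ℝ) ≠ 0 := by rw [sub_neg_eq_add]; exact hnpm
    have hsq : (n : ℝ) ^ 2 - (m : ℝ) ^ 2 ≠ 0 := by
      rw [show (n : ℝ) ^ 2 - (m : ℝ) ^ 2 = ((n : ℝ) + m) * ((n : ℝ) - m) by ring]
      exact mul_ne_zero hnpm hnmR
    set Im := ∫ t in Ioc 0 (2 * a), 1 / (2 * Real.cosh (t / 2)) * Real.sin (π * (m : ℝ) / a * t) with hIm
    set In := ∫ t in Ioc 0 (2 * a), 1 / (2 * Real.cosh (t / 2)) * Real.sin (π * (n : ℝ) / a * t) with hIn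
    field_simp
    ring

/-- **Odd-sector far column of the bonus block**: for `k ≠ l`, with `n = k+1`, `p = l+1`,
`Π⁻(k,l) = (−1)^{n+p}(n I_p − p I_n)/(π(n² − p²))`. -/
theorem sechBonus_oddCol_eq (a : ℝ) {k l : ℕ} (hkl : k ≠ l) :
    ((((if ((k : ℤ) + 1) = ((l : ℤ) + 1) then π else 0) - sechIncrCoeff a ((k : ℤ) + 1) ((l : ℤ) + 1))
      - ((if ((k : ℤ) + 1) = -((l : ℤ) + 1) then π else 0) - sechIncrCoeff a ((k : ℤ) + 1) (-((l : ℤ) + 1)))) / 2)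
      = (-1 : ℝ) ^ (((k : ℤ) + 1) + ((l : ℤ) + 1))
        * ((((k : ℝ) + 1) * ∫ t in Ioc 0 (2 * a), 1 / (2 * Real.cosh (t / 2)) * Real.sin (π * (((l : ℤ) + 1 : ℤ) : ℝ) / a * t))
          - ((l : ℝ) + 1) * ∫ t in Ioc 0 (2 * a), 1 / (2 * Real.cosh (t / 2)) * Real.sin (π * (((k : ℤ) + 1 : ℤ) : ℝ) / a * t))
        / (π * (((k : ℝ) + 1) ^ 2 - ((l : ℝ) + 1) ^ 2)) := by
  have hne : ((k : ℤ) + 1) ≠ ((l : ℤ) + 1) := by omega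
  have hne' : ((k : ℤ) + 1) ≠ -((l : ℤ) + 1) := by omega
  have hR : ((k : ℝ) + 1) - ((l : ℝ) + 1) ≠ 0 := by
    rw [add_sub_add_right_eq_sub]; exact sub_ne_zero.mpr (by exact_mod_cast hkl)
  have hR' : ((k : ℝ) + 1) + ((l : ℝ) + 1) ≠ 0 := by positivity
  rw [if_neg hne, if_neg hne']
  unfold sechIncrCoeff
  rw [if_neg hne, if_neg hne', sechSinMoment_neg a ((l : ℤ) + 1), neg_one_zpow_add_neg]
  push_cast
  have hR'' : ((k : ℝ) + 1) - -((l : ℝ) + 1) ≠ 0 := by rw [sub_neg_eq_add]; exact hR'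
  have hsq : ((k : ℝ) + 1) ^ 2 - ((l : ℝ) + 1) ^ 2 ≠ 0 := by
    rw [show ((k : ℝ) + 1) ^ 2 - ((l : ℝ) + 1) ^ 2 = (((k : ℝ) + 1) + ((l : ℝ) + 1)) * (((k : ℝ) + 1) - ((l : ℝ) + 1))
      by ring]
    exact mul_ne_zero hR' hR
  set Ip := ∫ t in Ioc 0 (2 * a), 1 / (2 * Real.cosh (t / 2)) * Real.sin (π * ((l : ℝ) + 1) / a * t) with hIp
  set In := ∫ t in Ioc 0 (2 * a), 1 / (2 * Real.cosh (t / 2)) * Real.sin (π * ((k : ℝ) + 1) / a * t) with hIn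
  field_simp
  ring

end Columns

/-! ## Decay of the sector columns -/

section Decay

/-- **Even sector**: `2n ≤ m`, `1 ≤ m` ⟹ `|Π⁺(n,m)| ≤ 8a/(3π² m²)`. -/
theorem abs_sechBonus_evenCol_le (ha : 0 < a) {n m : ℕ} (hnm : 2 * n ≤ m) (hm : 1 ≤ m) :
    |(if n = 0 then ((if (0 : ℤ) = (m : ℤ) then π else 0) - sechIncrCoeff a 0 m)
      else if m = 0 then ((if (n : ℤ) = 0 then π else 0) - sechIncrCoeff a n 0)
      else (((if (n : ℤ) = m then π else 0) - sechIncrCoeff a n m)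
        + ((if (n : ℤ) = -(m : ℤ) then π else 0) - sechIncrCoeff a n (-(m : ℤ)))) / 2)|
      ≤ 8 * a / (3 * π ^ 2 * (m : ℝ) ^ 2) := by
  have hm0 : m ≠ 0 := by omega
  have hnm' : n ≠ m := by omega
  rw [sechBonus_evenCol_eq a hm0 hnm']
  have hM : |(m : ℝ)| * |∫ t in Ioc 0 (2 * a), 1 / (2 * Real.cosh (t / 2)) * Real.sin (π * (m : ℝ) / a * t)|
      ≤ a / π := by
    have h := abs_mul_abs_sechSinMoment_le ha (m : ℤ)
    simpa only [Int.cast_natCast] using h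
  have hN : |(n : ℝ)| * |∫ t in Ioc 0 (2 * a), 1 / (2 * Real.cosh (t / 2)) * Real.sin (π * (n : ℝ) / a * t)|
      ≤ a / π := by
    have h := abs_mul_abs_sechSinMoment_le ha (n : ℤ)
    simpa only [Int.cast_natCast] using h
  set Im := ∫ t in Ioc 0 (2 * a), 1 / (2 * Real.cosh (t / 2)) * Real.sin (π * (m : ℝ) / a * t) with hIm
  set In := ∫ t in Ioc 0 (2 * a), 1 / (2 * Real.cosh (t / 2)) * Real.sin (π * (n : ℝ) / a * t) with hIn
  have hmR : (1 : ℝ) ≤ m := by exact_mod_cast hm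
  have hnmR : 2 * (n : ℝ) ≤ m := by exact_mod_cast hnm
  have hn0 : (0 : ℝ) ≤ n := by positivity
  have hden : 3 / 4 * (m : ℝ) ^ 2 ≤ (m : ℝ) ^ 2 - (n : ℝ) ^ 2 := by nlinarith
  have hdenpos : 0 < (m : ℝ) ^ 2 - (n : ℝ) ^ 2 := by nlinarith
  have hnum : |(m : ℝ) * Im - n * In| ≤ 2 * a / π :=
    calc |(m : ℝ) * Im - n * In| ≤ |(m : ℝ) * Im| + |(n : ℝ) * In| := abs_sub _ _
      _ = |(m : ℝ)| * |Im| + |(n : ℝ)| * |In| := by rw [abs_mul, abs_mul]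
      _ ≤ a / π + a / π := add_le_add hM hN
      _ = 2 * a / π := by ring
  rw [abs_div, abs_mul, abs_neg_one_zpow, one_mul, abs_mul, abs_of_pos Real.pi_pos,
    show |((n : ℝ) ^ 2 - (m : ℝ) ^ 2)| = (m : ℝ) ^ 2 - (n : ℝ) ^ 2 by
      rw [abs_sub_comm]; exact abs_of_pos hdenpos]
  rw [div_le_div_iff₀ (by positivity) (by positivity)]
  have hπ := Real.pi_pos
  have h1 : |(m : ℝ) * Im - n * In| * π ≤ 2 * a := (le_div_iff₀ hπ).mp hnum
  have h2 : |(m : ℝ) * Im - n * In| * (3 * π ^ 2 * (m : ℝ) ^ 2)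
      = (|(m : ℝ) * Im - n * In| * π) * (3 * π * (m : ℝ) ^ 2) := by ring
  rw [h2]
  have h3 : (|(m : ℝ) * Im - n * In| * π) * (3 * π * (m : ℝ) ^ 2) ≤ (2 * a) * (3 * π * (m : ℝ) ^ 2) :=
    mul_le_mul_of_nonneg_right h1 (by positivity)
  nlinarith [h3, mul_le_mul_of_nonneg_left hden (le_of_lt (mul_pos ha hπ))]

/-- **Odd sector**: `2(k+1) ≤ l+1` ⟹ `|Π⁻(k,l)| ≤ 8a/(3π²(k+1)(l+1))`. -/
theorem abs_sechBonus_oddCol_le (ha : 0 < a) {k l : ℕ} (hkl : 2 * (k + 1) ≤ l + 1) :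
    |((((if ((k : ℤ) + 1) = ((l : ℤ) + 1) then π else 0) - sechIncrCoeff a ((k : ℤ) + 1) ((l : ℤ) + 1))
      - ((if ((k : ℤ) + 1) = -((l : ℤ) + 1) then π else 0) - sechIncrCoeff a ((k : ℤ) + 1) (-((l : ℤ) + 1)))) / 2)|
      ≤ 8 * a / (3 * π ^ 2 * (((k : ℝ) + 1) * ((l : ℝ) + 1))) := by
  have hkl' : k ≠ l := by omega
  rw [sechBonus_oddCol_eq a hkl']
  have hP : ((l : ℝ) + 1) * |∫ t in Ioc 0 (2 * a), 1 / (2 * Real.cosh (t / 2))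
      * Real.sin (π * (((l : ℤ) + 1 : ℤ) : ℝ) / a * t)| ≤ a / π := by
    have h := abs_mul_abs_sechSinMoment_le ha ((l : ℤ) + 1)
    have hc : |(((l : ℤ) + 1 : ℤ) : ℝ)| = (l : ℝ) + 1 := by push_cast; exact abs_of_pos (by positivity)
    rw [hc] at h
    exact h
  have hN : ((k : ℝ) + 1) * |∫ t in Ioc 0 (2 * a), 1 / (2 * Real.cosh (t / 2))
      * Real.sin (π * (((k : ℤ) + 1 : ℤ) : ℝ) / a * t)| ≤ a / π := by
    have h := abs_mul_abs_sechSinMoment_le ha ((k : ℤ) + 1)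
    have hc : |(((k : ℤ) + 1 : ℤ) : ℝ)| = (k : ℝ) + 1 := by push_cast; exact abs_of_pos (by positivity)
    rw [hc] at h
    exact h
  set Ip := ∫ t in Ioc 0 (2 * a), 1 / (2 * Real.cosh (t / 2)) * Real.sin (π * (((l : ℤ) + 1 : ℤ) : ℝ) / a * t)
    with hIp
  set In := ∫ t in Ioc 0 (2 * a), 1 / (2 * Real.cosh (t / 2)) * Real.sin (π * (((k : ℤ) + 1 : ℤ) : ℝ) / a * t)
    with hIn
  set nn : ℝ := (k : ℝ) + 1 with hnn
  set pp : ℝ := (l : ℝ) + 1 with hpp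
  have hn1 : (1 : ℝ) ≤ nn := by simp only [hnn]; linarith [(Nat.cast_nonneg k : (0 : ℝ) ≤ k)]
  have hnp : 2 * nn ≤ pp := by simp only [hnn, hpp]; exact_mod_cast hkl
  have hnpos : 0 < nn := by linarith
  have hppos : 0 < pp := by linarith
  have hden : 3 / 4 * pp ^ 2 ≤ pp ^ 2 - nn ^ 2 := by nlinarith
  have hdenpos : 0 < pp ^ 2 - nn ^ 2 := by nlinarith
  -- `|nn I_p − pp I_n| ≤ nn·(a/π)/pp + pp·(a/π)/nn`
  have hIp' : |Ip| ≤ a / π / pp := by rw [le_div_iff₀ hppos, mul_comm]; exact hP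
  have hIn' : |In| ≤ a / π / nn := by rw [le_div_iff₀ hnpos, mul_comm]; exact hN
  have hnum : |nn * Ip - pp * In| ≤ nn * (a / π / pp) + pp * (a / π / nn) := by
    refine (abs_sub _ _).trans ?_
    rw [abs_mul, abs_mul, abs_of_pos hnpos, abs_of_pos hppos]
    exact add_le_add (mul_le_mul_of_nonneg_left hIp' hnpos.le) (mul_le_mul_of_nonneg_left hIn' hppos.le)
  rw [abs_div, abs_mul, abs_neg_one_zpow, one_mul, abs_mul, abs_of_pos Real.pi_pos,
    show |(nn ^ 2 - pp ^ 2)| = pp ^ 2 - nn ^ 2 by rw [abs_sub_comm]; exact abs_of_pos hdenpos]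
  -- reduce to an inequality between explicit rationals in nn, pp, a, π
  have hπ := Real.pi_pos
  have hkey : (nn * (a / π / pp) + pp * (a / π / nn)) / (π * (pp ^ 2 - nn ^ 2))
      ≤ 8 * a / (3 * π ^ 2 * (nn * pp)) := by
    rw [div_le_div_iff₀ (by positivity) (by positivity)]
    have e1 : (nn * (a / π / pp) + pp * (a / π / nn)) * (3 * π ^ 2 * (nn * pp))
        = 3 * π * a * (nn ^ 2 + pp ^ 2) := by
      field_simp
    rw [e1]
    -- 3πa(nn² + pp²) ≤ 8a·π(pp² − nn²)  ⟸  3nn² + 3pp² ≤ 8pp² − 8nn²  ⟸  11nn² ≤ 5pp² ⟸ 4nn² ≤ pp²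
    have h4 : 4 * nn ^ 2 ≤ pp ^ 2 := by nlinarith
    nlinarith [mul_pos hπ ha]
  exact (div_le_div_of_nonneg_right hnum (by positivity)).trans hkey

end Decay

end Summit.Ventures.WeilGRH

end
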